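import Literature.NumberTheory.GaloisRepresentations.FrobeniusDensityTheorem
import Literature.NumberTheory.Automorphic.GaloisActionPlaces
import Mathlib.NumberTheory.Cyclotomic.Gal
import Mathlib.NumberTheory.DirichletCharacter.Orthogonality
import Mathlib.GroupTheory.FiniteAbelian.Duality
import HarnessLib

/-!
# Frobenius elements of a cyclotomic extension `K(ζ_m)/K` and norms of primes modulo `m`

Topic `Literature/NumberTheory/GaloisRepresentations`; theorems only (no `sorry`, no new named
fact, no new definition).  The "reciprocity law" of the cyclotomic extension `N = K(ζ_m)` of a
number field `K` (Tate, *Global class field theory*, Ch. VII of Cassels–Fröhlich, §3.4,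
Proposition: "`F(v_p)ζ = ζ^p` for all `p ∉ S`" over `ℚ`, and Prop. 3.2, `F_{L'/K'} = F_{L/K} ∘ N`,
for the base change to `K`): with `χ_cyc : Gal(N/K) ↪ (ℤ/m)ˣ` Mathlib's
`IsPrimitiveRoot.autToPow` (injective, `autToPow_injective`),

* `autToPow_eq_absNorm_of_isArithFrobAt` — **`χ_cyc(Frob_v) = N(v) mod m`** for `v ∤ m` (from
  Mathlib's `AlgHom.IsArithFrobAt.apply_of_pow_eq_one`);
* `forall_frob_eq_iff_autToPow_eq` — all Frobenii above `v ∤ m` equal `τ` iff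
  `χ_cyc(τ) = N(v) mod m`; `exists_autToPow_eq_absNorm` — `N(v) mod m ∈ χ_cyc(Gal(N/K))`;
* `mem_splitPrimes_iff_natCast_absNorm_eq_one` — `v ∤ m` unramified splits completely in `N`
  iff `N(v) ≡ 1 (mod m)` (Tate, Prop. 2.3: "`v` splits completely iff `F_{L/K}(v) = 1`");
* `closure_frobenius_eq_top` — **the Frobenii (outside any finite set of primes) generate the
  Galois group** of an abelian extension of number fields: the fixed field `E` of the subgroup
  they generate has its completely split primes of strong Dirichlet density `1` and `1/[E:K]`
  (the tree's `hasStrongDirichletDensity_splitPrimes`, Marcus Ch. 7 Thm. 43), so `E = K`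
  (`HasStrongDirichletDensity.unique`, proved here); hence `exists_apply_absNorm_ne_one`: a
  Dirichlet character `ψ mod m` nontrivial on `χ_cyc(Gal(N/K))` has `ψ(N(v)) ≠ 1` for some
  `v ∤ m` outside any finite set;
* `card_dirichletCharacter_trivial_mul_card_le` — `#{ψ mod m : ψ|_H = 1} · #H ≤ φ(m)` for a
  subgroup `H ≤ (ℤ/m)ˣ` (inject into the characters of `(ℤ/m)ˣ/H` and count them with Mathlib's
  `CommGroup.card_monoidHom_of_hasEnoughRootsOfUnity`).

These are the Galois-side inputs of Dirichlet's theorem for `K(ζ_m)/K` (planned,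
`CyclotomicChebotarevProofs.lean`), the last step of the reduction of the named facts
`chebotarev_cyclotomicExtension` / `chebotarev_artinRep` / `chebotarev_geomTorsion` to the
regularity of ray class `L`-series at `s = 1`
(`Literature.NumberTheory.LFunctions.rayClassLSeries_tendsto_nhdsGT_one`).

## References

* J. Tate, *Global class field theory*, Ch. VII of Cassels–Fröhlich (1967), Prop. 2.3, Prop. 3.2,
  §3.4 Proposition. [TateGCFT1967]
* D. A. Marcus, *Number Fields*, 2nd ed. (2018), Ch. 7 Thm. 43. [Marcus2018]
* J. Neukirch, *Algebraic Number Theory* (1999), VII (13.9). [NeukirchANT1999]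
-/

noncomputable section

open NumberField IsDedekindDomain Filter

open scoped _root_.Topology Classical

namespace Literature.NumberTheory.GaloisRepresentations

/-! ### Uniqueness of strong Dirichlet densities -/

/-- The logarithmic prime asymptotic constant is unique. [folklore] -/
theorem _root_.Literature.NumberTheory.LFunctions.HasPrimeLogAsymp.unique {f : ℕ → ℝ} {c c' : ℝ}
    (h : LFunctions.HasPrimeLogAsymp f c) (h' : LFunctions.HasPrimeLogAsymp f c') : c = c' := by
  obtain ⟨L, hL⟩ := h
  obtain ⟨L', hL'⟩ := h'
  -- `(c - c') log (s-1) → L - L'`, but `log (s-1) → -∞`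
  have hsub : Tendsto (fun s : ℝ => (c - c') * Real.log (s - 1)) (𝓝[>] (1 : ℝ)) (𝓝 (L - L')) := by
    refine (hL.sub hL').congr' ?_
    filter_upwards with s
    ring
  by_contra hne
  have hlog : Tendsto (fun s : ℝ => Real.log (s - 1)) (𝓝[>] (1 : ℝ)) atBot := by
    have hsub1 : Tendsto (fun s : ℝ => s - 1) (𝓝[>] (1 : ℝ)) (𝓝[>] 0) := by
      refine tendsto_nhdsWithin_iff.mpr ⟨?_, ?_⟩
      · have : Tendsto (fun s : ℝ => s - 1) (𝓝 1) (𝓝 (1 - 1)) :=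
          (continuous_sub_right (1 : ℝ)).tendsto 1
        rw [sub_self] at this
        exact tendsto_nhdsWithin_of_tendsto_nhds this
      · filter_upwards [self_mem_nhdsWithin] with s (hs : 1 < s)
        exact sub_pos.mpr hs
    exact Real.tendsto_log_nhdsGT_zero.comp hsub1
  have hmul : Tendsto (fun s : ℝ => (c - c') * Real.log (s - 1)) (𝓝[>] (1 : ℝ))
      (if 0 < c - c' then atBot else atTop) := by
    rcases lt_or_gt_of_ne (sub_ne_zero.mpr hne) with hneg | hpos
    · rw [if_neg (not_lt.mpr hneg.le)]
      exact hlog.const_mul_atBot_of_neg hneg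
    · rw [if_pos hpos]
      exact hlog.const_mul_atBot hpos
  split_ifs at hmul
  · exact not_tendsto_nhds_of_tendsto_atBot hmul _ hsub
  · exact not_tendsto_nhds_of_tendsto_atTop hmul _ hsub

/-- Strong Dirichlet densities are unique. [folklore] -/
theorem _root_.Literature.NumberTheory.LFunctions.HasStrongDirichletDensity.unique {M : Type*}
    [Field M] [NumberField M] {X : Set (HeightOneSpectrum (𝓞 M))} {c c' : ℝ}
    (h : LFunctions.HasStrongDirichletDensity M X c) (h' : LFunctions.HasStrongDirichletDensity M X c') :
    c = c' :=
  LFunctions.HasPrimeLogAsymp.unique h h'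

/-! ### The Frobenius of `K(ζ_m)/K` acts on `ζ_m` by the norm -/

section Cyclotomic

variable {K N : Type*} [Field K] [NumberField K] [Field N] [NumberField N] [Algebra K N]
  {m : ℕ} [NeZero m] {ζ : N} (hζ : IsPrimitiveRoot ζ m)

omit [NumberField N] in
include hζ in
/-- **The Frobenius of a prime `v ∤ m` in `K(ζ_m)/K` raises `ζ_m` to the power `N(v)`**:
`χ_cyc(Frob_v) = N(v) mod m` (Tate, *Global class field theory*, Ch. VII of Cassels–Fröhlich,
§3.4, Proposition: "`F(v_p)ζ = ζ^p`", with Prop. 3.2, `F_{L'/K'} = F_{L/K} ∘ N_{K'/K}`; Mathlib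
`AlgHom.IsArithFrobAt.apply_of_pow_eq_one`: a Frobenius at `𝔔 ∌ m` sends an `m`-th root of unity
`ζ` to `ζ^{N(v)}`).  Here `v` is a nonzero prime of `𝓞 K` with `m ∉ v`, `𝔔` a prime of
`𝓞 N` above `v`, and `φ ∈ Gal(N/K)` any arithmetic Frobenius at `𝔔`.
[cite: TateGCFT1967, §3.4 Proposition with Prop. 3.2] -/
theorem autToPow_eq_absNorm_of_isArithFrobAt {v : HeightOneSpectrum (𝓞 K)}
    (hm : (m : 𝓞 K) ∉ v.asIdeal) {Q : Ideal (𝓞 N)} (hQ : Q ∈ v.asIdeal.primesOver (𝓞 N))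
    {φ : N ≃ₐ[K] N} (hφ : IsArithFrobAt (𝓞 K) φ Q) :
    ((hζ.autToPow K φ : (ZMod m)ˣ) : ZMod m) = ((Ideal.absNorm v.asIdeal : ℕ) : ZMod m) := by
  haveI := hQ.1
  have hover : Q.under (𝓞 K) = v.asIdeal := hQ.2.over.symm
  have hpos : 0 < m := Nat.pos_of_ne_zero (NeZero.ne m)
  -- `φ ζ = ζ ^ N(v)` in `𝓞 N`
  set ζ' : 𝓞 N := ⟨ζ, hζ.isIntegral hpos⟩ with hζ'
  have hcoe : (ζ' : N) = ζ := rfl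
  have hζ'm : ζ' ^ m = 1 := by
    apply Subtype.ext
    change ζ ^ m = 1
    exact hζ.pow_eq_one
  have hmQ : ((m : ℕ) : 𝓞 N) ∉ Q := by
    intro h
    apply hm
    rw [← hover, Ideal.under, Ideal.mem_comap, map_natCast]
    exact h
  have h1 := hφ.apply_of_pow_eq_one hζ'm hmQ
  rw [hover] at h1
  -- pass to `N`
  have hcard : Nat.card (𝓞 K ⧸ v.asIdeal) = Ideal.absNorm v.asIdeal := by
    rw [← Submodule.cardQuot_apply, ← Ideal.absNorm_apply]
  rw [hcard] at h1
  have h2 : φ ζ = ζ ^ Ideal.absNorm v.asIdeal := by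
    have := congrArg (fun x : 𝓞 N => (x : N)) h1
    exact this
  -- compare with `autToPow`
  have hspec := hζ.autToPow_spec K φ
  rw [h2] at hspec
  have h3 : ζ ^ Ideal.absNorm v.asIdeal = ζ ^ (Ideal.absNorm v.asIdeal % m) := by
    conv_lhs => rw [← Nat.mod_add_div (Ideal.absNorm v.asIdeal) m, pow_add, pow_mul,
      hζ.pow_eq_one, one_pow, mul_one]
  rw [h3] at hspec
  have h4 := hζ.pow_inj (ZMod.val_lt _) (Nat.mod_lt _ hpos) hspec
  rw [← ZMod.natCast_zmod_val ((hζ.autToPow K φ : (ZMod m)ˣ) : ZMod m), h4, ZMod.natCast_mod]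

include hζ in
/-- **Frobenius `= τ` iff `N(v) ≡ χ_cyc(τ) (mod m)`** for a prime `v ∤ m`: all Frobenii at all
primes of `N = K(ζ_m)` above `v` equal `τ` iff `χ_cyc(τ) = N(v) mod m` (the cyclotomic character
is injective, Mathlib `IsPrimitiveRoot.autToPow_injective`; Frobenii exist at every prime).
[folklore] -/
theorem forall_frob_eq_iff_autToPow_eq [IsCyclotomicExtension {m} K N]
    {v : HeightOneSpectrum (𝓞 K)} (hm : (m : 𝓞 K) ∉ v.asIdeal) (τ : N ≃ₐ[K] N) :
    (∀ Q ∈ v.asIdeal.primesOver (𝓞 N), ∀ φ : N ≃ₐ[K] N, IsArithFrobAt (𝓞 K) φ Q → φ = τ) ↔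
      ((hζ.autToPow K τ : (ZMod m)ˣ) : ZMod m) = ((Ideal.absNorm v.asIdeal : ℕ) : ZMod m) := by
  haveI : IsGalois K N := IsCyclotomicExtension.isGalois {m} K N
  constructor
  · intro h
    haveI := v.isMaximal
    obtain ⟨Q, hQmax, hQover⟩ :=
      Ideal.exists_maximal_ideal_liesOver_of_isIntegral (S := 𝓞 N) v.asIdeal
    have hQ : Q ∈ v.asIdeal.primesOver (𝓞 N) := ⟨hQmax.isPrime, hQover⟩
    haveI := hQmax.isPrime
    obtain ⟨φ, hφ⟩ := exists_isArithFrobAt_ringOfIntegers (M := K) Q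
      (Ideal.ne_bot_of_mem_primesOver v.ne_bot hQ)
    rw [← h Q hQ φ hφ]
    exact autToPow_eq_absNorm_of_isArithFrobAt hζ hm hQ hφ
  · intro h Q hQ φ hφ
    apply hζ.autToPow_injective (K := K)
    apply Units.ext
    rw [autToPow_eq_absNorm_of_isArithFrobAt hζ hm hQ hφ, h]

include hζ in
/-- The norm residue `N(v) mod m` of a prime `v ∤ m` lies in the image
`H = χ_cyc(Gal(K(ζ_m)/K)) ≤ (ℤ/m)ˣ` (it is `χ_cyc` of a Frobenius). [folklore] -/
theorem exists_autToPow_eq_absNorm [IsCyclotomicExtension {m} K N]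
    {v : HeightOneSpectrum (𝓞 K)} (hm : (m : 𝓞 K) ∉ v.asIdeal) :
    ∃ φ : N ≃ₐ[K] N, ((hζ.autToPow K φ : (ZMod m)ˣ) : ZMod m) =
      ((Ideal.absNorm v.asIdeal : ℕ) : ZMod m) := by
  haveI : IsGalois K N := IsCyclotomicExtension.isGalois {m} K N
  haveI := v.isMaximal
  obtain ⟨Q, hQmax, hQover⟩ :=
    Ideal.exists_maximal_ideal_liesOver_of_isIntegral (S := 𝓞 N) v.asIdeal
  have hQ : Q ∈ v.asIdeal.primesOver (𝓞 N) := ⟨hQmax.isPrime, hQover⟩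
  haveI := hQmax.isPrime
  obtain ⟨φ, hφ⟩ := exists_isArithFrobAt_ringOfIntegers (M := K) Q
    (Ideal.ne_bot_of_mem_primesOver v.ne_bot hQ)
  exact ⟨φ, autToPow_eq_absNorm_of_isArithFrobAt hζ hm hQ hφ⟩

include hζ in
/-- **A prime `v ∤ m` unramified in `K(ζ_m)` splits completely iff `N(v) ≡ 1 (mod m)`** (Tate,
Ch. VII of Cassels–Fröhlich, §2.3: "`v` splits completely if and only if `F_{L/K}(v) = 1`", and
§3.4). [cite: TateGCFT1967, Prop. 2.3 with §3.4 Proposition] -/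
theorem mem_splitPrimes_iff_natCast_absNorm_eq_one [IsCyclotomicExtension {m} K N]
    {v : HeightOneSpectrum (𝓞 K)} (hunr : Algebra.IsUnramifiedIn (𝓞 N) v.asIdeal)
    (hm : (m : 𝓞 K) ∉ v.asIdeal) :
    v ∈ splitPrimes K N ↔ ((Ideal.absNorm v.asIdeal : ℕ) : ZMod m) = 1 := by
  haveI : IsGalois K N := IsCyclotomicExtension.isGalois {m} K N
  haveI := v.isMaximal
  haveI : Finite (𝓞 K ⧸ v.asIdeal) := Ideal.finiteQuotientOfFreeOfNeBot _ v.ne_bot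
  have hq1 : 1 < Nat.card (𝓞 K ⧸ v.asIdeal) := by
    rw [← Submodule.cardQuot_apply, ← Ideal.absNorm_apply]
    exact NumberField.HeightOneSpectrum.one_lt_absNorm v
  -- `Frob = 1` at `Q` means `y^{N v} ≡ y (mod Q)` for all `y`
  have key : ∀ Q ∈ v.asIdeal.primesOver (𝓞 N),
      (IsArithFrobAt (𝓞 K) (1 : N ≃ₐ[K] N) Q ↔ Q.inertiaDeg (𝓞 K) = 1) := by
    intro Q hQ
    haveI := hQ.1
    haveI := hQ.2
    have hQne : Q ≠ ⊥ := Ideal.ne_bot_of_mem_primesOver v.ne_bot hQ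
    haveI : Q.IsMaximal := hQ.1.isMaximal hQne
    have hover : Q.under (𝓞 K) = v.asIdeal := hQ.2.over.symm
    constructor
    · intro h1
      refine inertiaDeg_eq_one_of_forall_pow_sub_mem' v.asIdeal Q hq1 fun y => ?_
      have := h1 y
      rw [MulSemiringAction.toAlgHom_apply, one_smul, hover] at this
      rw [← Ideal.neg_mem_iff, neg_sub]
      exact this
    · intro hf
      haveI : Finite (𝓞 N ⧸ Q) := Ideal.finiteQuotientOfFreeOfNeBot Q hQne
      letI : Fintype (𝓞 N ⧸ Q) := Fintype.ofFinite _
      letI : Field (𝓞 N ⧸ Q) := Ideal.Quotient.field Q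
      have hcard : Nat.card (𝓞 K ⧸ v.asIdeal) = Fintype.card (𝓞 N ⧸ Q) := by
        have h := Ideal.cardQuot_pow_inertiaDeg (R := 𝓞 K) v.asIdeal Q
        rw [hf, pow_one, Submodule.cardQuot_apply, Submodule.cardQuot_apply] at h
        rw [h, Nat.card_eq_fintype_card]
      intro y
      rw [MulSemiringAction.toAlgHom_apply, one_smul, hover, hcard, ← Ideal.neg_mem_iff, neg_sub,
        ← Ideal.Quotient.eq, map_pow]
      exact FiniteField.pow_card _
  constructor
  · intro hsplit
    obtain ⟨Q, hQmax, hQover⟩ :=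
      Ideal.exists_maximal_ideal_liesOver_of_isIntegral (S := 𝓞 N) v.asIdeal
    have hQ : Q ∈ v.asIdeal.primesOver (𝓞 N) := ⟨hQmax.isPrime, hQover⟩
    have h1 : IsArithFrobAt (𝓞 K) (1 : N ≃ₐ[K] N) Q := (key Q hQ).mpr (hsplit.2 Q hQ)
    rw [← autToPow_eq_absNorm_of_isArithFrobAt hζ hm hQ h1, map_one, Units.val_one]
  · intro h1
    have hall := (forall_frob_eq_iff_autToPow_eq hζ hm (1 : N ≃ₐ[K] N)).mpr
      (by rw [map_one, Units.val_one, h1])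
    refine ⟨hunr, fun Q hQ => ?_⟩
    haveI := hQ.1
    obtain ⟨φ, hφ⟩ := exists_isArithFrobAt_ringOfIntegers (M := K) Q
      (Ideal.ne_bot_of_mem_primesOver v.ne_bot hQ)
    have hφ1 : φ = 1 := hall Q hQ φ hφ
    rw [hφ1] at hφ
    exact (key Q hQ).mp hφ

omit [NumberField K] [NumberField N] in
include hζ in
/-- `Gal(K(ζ_m)/K)` is commutative (it embeds into `(ℤ/m)ˣ`). [folklore] -/
theorem commute_of_isCyclotomicExtension [IsCyclotomicExtension {m} K N] (a b : N ≃ₐ[K] N) :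
    Commute a b := by
  have hinj := hζ.autToPow_injective (K := K)
  apply hinj
  rw [map_mul, map_mul, mul_comm]

/-- **The Frobenius elements generate the Galois group** of a finite Galois extension `N/K` of
number fields with commutative Galois group, even after discarding the Frobenii at any finite
set `B` of primes: the fixed field `E` of the subgroup they generate is Galois over `K` and every
prime `v ∉ B` unramified in `N` and `E` splits completely in `E` (its Frobenius fixes `E`), so the
completely split primes of `E/K` have strong Dirichlet density `1` as well as `1/[E:K]`
(`hasStrongDirichletDensity_splitPrimes`), whence `E = K`.  (Elementary substitute for the
Frobenius/Chebotarev density theorem; cf. Neukirch VII (13.9).) [folklore] -/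
theorem closure_frobenius_eq_top {K N : Type*} [Field K] [NumberField K] [Field N]
    [NumberField N] [Algebra K N] [IsGalois K N]
    (hcomm : ∀ a b : N ≃ₐ[K] N, Commute a b) {B : Set (HeightOneSpectrum (𝓞 K))}
    (hB : B.Finite) :
    Subgroup.closure {φ : N ≃ₐ[K] N | ∃ v : HeightOneSpectrum (𝓞 K), v ∉ B ∧
      ∃ Q ∈ v.asIdeal.primesOver (𝓞 N), IsArithFrobAt (𝓞 K) φ Q} = ⊤ := by
  set S := {φ : N ≃ₐ[K] N | ∃ v : HeightOneSpectrum (𝓞 K), v ∉ B ∧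
      ∃ Q ∈ v.asIdeal.primesOver (𝓞 N), IsArithFrobAt (𝓞 K) φ Q} with hSdef
  set G₀ := Subgroup.closure S with hG₀
  haveI hnormal : G₀.Normal := ⟨fun n hn g => by rwa [(hcomm g n).eq, mul_inv_cancel_right]⟩
  set E : IntermediateField K N := IntermediateField.fixedField G₀ with hEdef
  haveI : IsGalois K E := IsGalois.of_fixedField_normal_subgroup G₀
  haveI : NumberField E := NumberField.of_module_finite K E
  have hfix : E.fixingSubgroup = G₀ := IntermediateField.fixingSubgroup_fixedField G₀
  -- every good prime splits completely in `E`
  set Bad : Set (HeightOneSpectrum (𝓞 K)) := B ∪ {q | ¬ Algebra.IsUnramifiedIn (𝓞 N) q.asIdeal} ∪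
    {q | ¬ Algebra.IsUnramifiedIn (𝓞 E) q.asIdeal} with hBad
  have hBadfin : Bad.Finite :=
    (hB.union (finite_setOf_not_isUnramifiedIn K N)).union (finite_setOf_not_isUnramifiedIn K E)
  have hsplit : ∀ q ∉ Bad, q ∈ splitPrimes K E := by
    intro q hq
    simp only [hBad, Set.mem_union, Set.mem_setOf_eq, not_or, not_not] at hq
    obtain ⟨⟨hqB, hunrN⟩, hunrE⟩ := hq
    haveI := q.isMaximal
    obtain ⟨Q, hQmax, hQover⟩ :=
      Ideal.exists_maximal_ideal_liesOver_of_isIntegral (S := 𝓞 N) q.asIdeal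
    have hQ : Q ∈ q.asIdeal.primesOver (𝓞 N) := ⟨hQmax.isPrime, hQover⟩
    haveI := hQmax.isPrime
    obtain ⟨φ, hφ⟩ := exists_isArithFrobAt_ringOfIntegers (M := K) Q
      (Ideal.ne_bot_of_mem_primesOver q.ne_bot hQ)
    have hφS : φ ∈ S := ⟨q, hqB, Q, hQ, hφ⟩
    have hφG : φ ∈ E.fixingSubgroup := by
      rw [hfix, hG₀]
      exact Subgroup.subset_closure hφS
    exact (mem_splitPrimes_intermediateField_iff E hunrN hunrE hQ hφ).mpr hφG
  -- hence density `1 = 1/[E:K]`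
  have hd1 : LFunctions.HasStrongDirichletDensity K (splitPrimes K E) 1 :=
    (LFunctions.hasStrongDirichletDensity_univ K).of_finite_symmDiff hBadfin fun q hq =>
      ⟨fun _ => hsplit q hq, fun _ => Set.mem_univ q⟩
  have hd2 := hasStrongDirichletDensity_splitPrimes K E
  have heq : (1 : ℝ) = 1 / Module.finrank K E := hd1.unique hd2
  have hfin : Module.finrank K E = 1 := by
    have hpos : (0 : ℝ) < Module.finrank K E := by exact_mod_cast Module.finrank_pos
    have h1 : (Module.finrank K E : ℝ) = 1 := by
      field_simp at heq
      linarith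
    exact_mod_cast h1
  have hEbot : E = ⊥ := IntermediateField.finrank_eq_one_iff.mp hfin
  rw [← hfix, hEbot, IntermediateField.fixingSubgroup_bot]

include hζ in
/-- **A character of `Gal(K(ζ_m)/K)` which is nontrivial detects a norm**: if the Dirichlet
character `ψ mod m` is not identically `1` on `χ_cyc(Gal(K(ζ_m)/K))`, then `ψ(N(v) mod m) ≠ 1`
for some prime `v` outside any given finite set and with `m ∉ v` (the Frobenii outside a finite
set generate the Galois group, `closure_frobenius_eq_top`, and `χ_cyc(Frob_v) = N(v)`).
[folklore] -/
theorem exists_apply_absNorm_ne_one [IsCyclotomicExtension {m} K N] (ψ : DirichletCharacter ℂ m)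
    (hψ : ∃ g : N ≃ₐ[K] N, ψ ((hζ.autToPow K g : (ZMod m)ˣ) : ZMod m) ≠ 1)
    {B : Set (HeightOneSpectrum (𝓞 K))} (hB : B.Finite) :
    ∃ v : HeightOneSpectrum (𝓞 K), v ∉ B ∧ (m : 𝓞 K) ∉ v.asIdeal ∧
      ψ ((Ideal.absNorm v.asIdeal : ℕ) : ZMod m) ≠ 1 := by
  haveI : IsGalois K N := IsCyclotomicExtension.isGalois {m} K N
  obtain ⟨g, hg⟩ := hψ
  -- enlarge `B` by the finitely many primes dividing `m`
  have hmfin : {v : HeightOneSpectrum (𝓞 K) | (m : 𝓞 K) ∈ v.asIdeal}.Finite := by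
    have hI : (Ideal.span {(m : 𝓞 K)} : Ideal (𝓞 K)) ≠ ⊥ := by
      rw [Ne, Ideal.span_singleton_eq_bot]
      exact_mod_cast NeZero.ne m
    refine (Ideal.finite_factors hI).subset fun v hv => ?_
    simp only [Set.mem_setOf_eq] at hv ⊢
    exact (Ideal.dvd_iff_le).mpr ((Ideal.span_singleton_le_iff_mem _).mpr hv)
  have htop := closure_frobenius_eq_top (K := K) (N := N) (commute_of_isCyclotomicExtension hζ)
    (hB.union hmfin)
  -- the character `ψ ∘ χ_cyc` of `Gal(N/K)`
  set f : (N ≃ₐ[K] N) →* ℂˣ := (MulChar.toUnitHom ψ).comp (hζ.autToPow K) with hf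
  have hfapply : ∀ x : N ≃ₐ[K] N, ((f x : ℂˣ) : ℂ) = ψ ((hζ.autToPow K x : (ZMod m)ˣ) : ZMod m) :=
    fun x => by rw [hf, MonoidHom.comp_apply, MulChar.coe_toUnitHom]
  by_contra hcon
  have hcon' : ∀ v : HeightOneSpectrum (𝓞 K), v ∉ B → (m : 𝓞 K) ∉ v.asIdeal →
      ψ ((Ideal.absNorm v.asIdeal : ℕ) : ZMod m) = 1 := fun v h1 h2 => by
    by_contra h3
    exact hcon ⟨v, h1, h2, h3⟩
  -- then `f` kills all Frobenii outside `B ∪ {v ∋ m}`, hence everything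
  have hker : {φ : N ≃ₐ[K] N | ∃ v : HeightOneSpectrum (𝓞 K), v ∉ B ∪ {v | (m : 𝓞 K) ∈ v.asIdeal} ∧
      ∃ Q ∈ v.asIdeal.primesOver (𝓞 N), IsArithFrobAt (𝓞 K) φ Q} ⊆ (f.ker : Set (N ≃ₐ[K] N)) := by
    rintro φ ⟨v, hv, Q, hQ, hφ⟩
    simp only [Set.mem_union, Set.mem_setOf_eq, not_or] at hv
    rw [SetLike.mem_coe, MonoidHom.mem_ker]
    apply Units.ext
    rw [hfapply, Units.val_one, autToPow_eq_absNorm_of_isArithFrobAt hζ hv.2 hQ hφ]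
    exact hcon' v hv.1 hv.2
  have hle : (⊤ : Subgroup (N ≃ₐ[K] N)) ≤ f.ker := by
    rw [← htop]
    exact (Subgroup.closure_le _).mpr hker
  have hg1 : f g = 1 := hle (Subgroup.mem_top g)
  apply hg
  rw [← hfapply, hg1, Units.val_one]

end Cyclotomic

/-! ### Counting the Dirichlet characters trivial on a subgroup of `(ℤ/m)ˣ` -/

/-- **`#{ψ mod m : ψ|_H = 1} · #H ≤ φ(m)`** for a subgroup `H ≤ (ℤ/m)ˣ`: the characters trivial
on `H` inject into the characters of `(ℤ/m)ˣ/H`, of which there are `#((ℤ/m)ˣ/H)` (Mathlib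
`CommGroup.card_monoidHom_of_hasEnoughRootsOfUnity`). [folklore] -/
theorem card_dirichletCharacter_trivial_mul_card_le {m : ℕ} [NeZero m] (H : Subgroup (ZMod m)ˣ) :
    Nat.card {ψ : DirichletCharacter ℂ m // ∀ h ∈ H, ψ ((h : (ZMod m)ˣ) : ZMod m) = 1} *
      Nat.card H ≤ m.totient := by
  set Q := (ZMod m)ˣ ⧸ H with hQ
  haveI : NeZero (Monoid.exponent Q) := ⟨Monoid.exponent_ne_zero_of_finite (G := Q)⟩
  have hcardQ : Nat.card (Q →* ℂˣ) = Nat.card Q :=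
    CommGroup.card_monoidHom_of_hasEnoughRootsOfUnity Q ℂ
  haveI : Finite (Q →* ℂˣ) := Nat.finite_of_card_ne_zero (by rw [hcardQ]; exact Nat.card_pos.ne')
  have htot : Nat.card Q * Nat.card H = m.totient := by
    rw [hQ, ← Subgroup.card_eq_card_quotient_mul_card_subgroup H, Nat.card_eq_fintype_card,
      ZMod.card_units_eq_totient]
  rw [← htot, ← hcardQ]
  refine Nat.mul_le_mul_right _ ?_
  -- the injection `ψ ↦ (u H ↦ ψ u)`
  refine Nat.card_le_card_of_injective (fun ψ => QuotientGroup.lift H (MulChar.toUnitHom ψ.1)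
    fun h hh => ?_) ?_
  · apply Units.ext
    rw [MulChar.coe_toUnitHom, Units.val_one]
    exact ψ.2 h hh
  · intro ψ₁ ψ₂ h12
    apply Subtype.ext
    apply MulChar.ext
    intro u
    have h := congrArg (fun F : Q →* ℂˣ => ((F (QuotientGroup.mk u) : ℂˣ) : ℂ)) h12
    rw [← MulChar.coe_toUnitHom, ← MulChar.coe_toUnitHom]
    exact h

end Literature.NumberTheory.GaloisRepresentations
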